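import Mathlib.NumberTheory.Padics.RingHoms
import Mathlib.RingTheory.RootsOfUnity.PrimitiveRoots
import Mathlib.FieldTheory.Finite.Basic
import HarnessLib

/-!
# Multiplicative representatives in `ℤ_p`: the `(p−1)`-th roots of unity (Serre, *A Course in
# Arithmetic*, Ch. II §3.1, Prop. 7)

`Literature/NumberTheory/LocalFields/PadicMultiplicativeRepresentatives.lean`. Serre, Prop. 7:
"`U = V × U₁` where `V = {x ∈ U | x^{p−1} = 1}` is the unique subgroup of `U` isomorphic to `F_p^*`";
Corollary: "`ℚ_p` contains the `(p−1)`-th roots of unity"; Remark 1: `V` is "the group of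
multiplicative representatives of the elements of `F_p^*`". We prove, for every prime `p`:

* (a primitive `(p−1)`-th root of unity `ζ ∈ ℤ_p` EXISTS — Serre's Corollary — is already the
  tree's `Literature.NumberTheory.EllipticCurves.Kato2004.padicInt_exists_isPrimitiveRoot_sub_one`
  (Hensel lift of a generator of `(ℤ/p)^×`; also `hasEnoughRootsOfUnity_padicInt`), not restated;
  the theorems below take such a `ζ` as a hypothesis;)
* `padicInt_norm_rootOfUnity_sub_one` — a `(p−1)`-th root of unity `η ≠ 1` has `‖η − 1‖ = 1`
  (`V ∩ U₁ = 1`: if `η ≡ 1` then `0 = 1 + η + ⋯ + η^{m−1} ≡ m (mod p)` with `m ∣ p − 1`);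
* `padicInt_exists_norm_sub_pow_lt` / `padicInt_exists_norm_mul_pow_sub_one_lt` — **`U = V·U₁`**:
  for a fixed primitive `ζ` and any unit `α` there is `r < p − 1` with `‖α − ζʳ‖ < 1`, and
  `r' < p − 1` with `‖α ζ^{r'} − 1‖ < 1`.

This is the Teichmüller twist set-up (2.19)–(2.24) of Yu 1990 for `K = ℚ` (`f_℘ = e_℘ = 1`,
`G = p − 1`: "there exist `r'_j ∈ ℤ` such that `ord_p(αⱼ ζ^{r'_j} − 1) ≥ 1/e_℘`"), used by the
abc cell's route `PadicPrimesYuNinety` (engine `EngineThreeModFour`). The general local-field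
version (Teichmüller representatives `ω = lim u^{qⁿ}` in the cell's MLF setting) is
`Literature.IUT.LogVolume.exists_teichmuller`; this file is the elementary `ℤ_p` statement with a
PRIMITIVE root, which that file does not give. Not here: uniqueness of `V` as a subgroup.

## References
* [Serre1973] J.-P. Serre, *A Course in Arithmetic*, GTM 7, Springer 1973 — Ch. II §3.1, Prop. 7,
  Corollary, Remark 1.
* [Yu1990] Kunrui Yu, *Linear forms in p-adic logarithms II*, Compositio Math. 74 (1990) —
  (2.19)–(2.24), p. 33–34.
-/

noncomputable section

open Polynomial

namespace Literature.NumberTheory.LocalFields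

variable {p : ℕ} [Fact p.Prime]

/-- Elements of the maximal ideal of `ℤ_p` are exactly those killed by reduction mod `p`.
[folklore] -/
private theorem norm_lt_one_iff_toZMod_eq_zero (x : ℤ_[p]) :
    ‖x‖ < 1 ↔ PadicInt.toZMod x = 0 := by
  rw [← PadicInt.mem_nonunits, ← IsLocalRing.mem_maximalIdeal, ← PadicInt.ker_toZMod,
    RingHom.mem_ker]

/-- **`V ∩ U₁ = {1}`:** a `(p−1)`-th root of unity `η ≠ 1` in `ℤ_p` is NOT congruent to `1` mod `p`,
i.e. `‖η − 1‖ = 1` (if `η ≡ 1` had order `m > 1`, `m ∣ p − 1`, then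
`0 = 1 + η + ⋯ + η^{m−1} ≡ m (mod p)`, so `p ∣ m ∣ p − 1`). Distinct multiplicative representatives
are incongruent mod `p`. [cite: Serre1973, Ch. II §3.1 Prop. 7 (U = V × U₁)] -/
theorem padicInt_norm_rootOfUnity_sub_one {η : ℤ_[p]} (hη : η ^ (p - 1) = 1) (hη1 : η ≠ 1) :
    ‖η - 1‖ = 1 := by
  classical
  have hp : p.Prime := Fact.out
  by_contra hne
  have hlt : ‖η - 1‖ < 1 := lt_of_le_of_ne (PadicInt.norm_le_one _) hne
  rw [norm_lt_one_iff_toZMod_eq_zero, map_sub, map_one, sub_eq_zero] at hlt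
  -- the order `m` of `η`
  set m := orderOf η with hm
  have hprim : IsPrimitiveRoot η m := IsPrimitiveRoot.orderOf η
  have hmdvd : m ∣ p - 1 := orderOf_dvd_of_pow_eq_one hη
  have hm0 : 0 < m := Nat.pos_of_dvd_of_pos hmdvd (by have := hp.two_le; omega)
  have hm1 : 1 < m := by
    rcases Nat.lt_or_ge 1 m with h | h
    · exact h
    · exfalso
      have hm1 : m = 1 := le_antisymm h hm0
      apply hη1
      have := pow_orderOf_eq_one η
      rwa [← hm, hm1, pow_one] at this
  have hsum := hprim.geom_sum_eq_zero hm1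
  have hsum' := congrArg PadicInt.toZMod hsum
  rw [map_sum, map_zero] at hsum'
  simp only [map_pow, hlt, one_pow, Finset.sum_const, Finset.card_range, nsmul_eq_mul,
    mul_one] at hsum'
  -- `(m : ZMod p) = 0 ⇒ p ∣ m ∣ p - 1`
  rw [ZMod.natCast_eq_zero_iff] at hsum'
  have h1 : p ≤ p - 1 := Nat.le_of_dvd (by have := hp.two_le; omega) (hsum'.trans hmdvd)
  have := hp.two_le
  omega

/-- **Serre, Ch. II Prop. 7: `U = V × U₁` in `ℤ_p` — Teichmüller twist for `K = ℚ`.** For a fixed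
primitive `(p−1)`-th root of unity `ζ ∈ ℤ_p` and any unit `α ∈ ℤ_p^×` there is `r < p − 1` with
`α ≡ ζʳ (mod p)`, i.e. `‖α − ζʳ‖ < 1` (the powers `ζʳ`, `r < p − 1`, are pairwise incongruent mod
`p` by `padicInt_norm_rootOfUnity_sub_one`, hence exhaust `(ℤ/pℤ)^×`). This is Yu's "there exist
`r'ⱼ ∈ ℤ` such that `ord_p(αⱼ ζ^{r'ⱼ} − 1) ≥ 1/e_℘`" for `K = ℚ`. [cite: Serre1973, Ch. II §3.1 Prop. 7]
[cite: Yu1990, (2.19)–(2.24) (pp. 33–34)] -/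
theorem padicInt_exists_norm_sub_pow_lt {ζ : ℤ_[p]} (hζ : IsPrimitiveRoot ζ (p - 1)) {α : ℤ_[p]}
    (hα : ‖α‖ = 1) : ∃ r : ℕ, r < p - 1 ∧ ‖α - ζ ^ r‖ < 1 := by
  classical
  have hp : p.Prime := Fact.out
  have hp1 : 0 < p - 1 := by have := hp.two_le; omega
  -- the reduction of `r ↦ ζ^r` on `Fin (p-1)` is injective into `(ZMod p)ˣ`
  have hζu : IsUnit ζ := hζ.isUnit hp1.ne'
  have hζn : ‖ζ‖ = 1 := PadicInt.isUnit_iff.mp hζu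
  let f : Fin (p - 1) → (ZMod p)ˣ := fun r =>
    ((PadicInt.isUnit_iff.mpr (by rw [norm_pow, hζn, one_pow])).map PadicInt.toZMod :
      IsUnit (PadicInt.toZMod (ζ ^ (r : ℕ)))).unit
  have hfval : ∀ r : Fin (p - 1), (f r : ZMod p) = PadicInt.toZMod (ζ ^ (r : ℕ)) := fun r => rfl
  have hinj : Function.Injective f := by
    intro r s hrs
    have hrs' : PadicInt.toZMod (ζ ^ (r : ℕ)) = PadicInt.toZMod (ζ ^ (s : ℕ)) := by
      rw [← hfval, ← hfval, hrs]
    -- WLOG compare `η = ζ^(r-s)`-type element: use `ζ^r = ζ^s · η`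
    by_contra hne
    wlog hlt : (s : ℕ) < r generalizing r s
    · exact this hrs.symm hrs'.symm (Ne.symm hne) (by
        have : (r : ℕ) ≠ s := fun h => hne (Fin.ext h)
        omega)
    set d : ℕ := (r : ℕ) - s with hd
    have hd0 : 0 < d := by omega
    have hdlt : d < p - 1 := by have := r.2; omega
    have hη : (ζ ^ d) ^ (p - 1) = 1 := by rw [← pow_mul, mul_comm, pow_mul, hζ.pow_eq_one, one_pow]
    have hη1 : ζ ^ d ≠ 1 := by
      intro h
      have := hζ.dvd_of_pow_eq_one d h
      exact absurd (Nat.le_of_dvd hd0 this) (by omega)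
    have hnorm := padicInt_norm_rootOfUnity_sub_one hη hη1
    -- but `ζ^r ≡ ζ^s` gives `ζ^d ≡ 1`
    have hcong : PadicInt.toZMod (ζ ^ d - 1) = 0 := by
      have hsplit : ζ ^ (r : ℕ) = ζ ^ (s : ℕ) * ζ ^ d := by rw [← pow_add]; congr 1; omega
      rw [hsplit, map_mul] at hrs'
      have hzs : PadicInt.toZMod (ζ ^ (s : ℕ)) ≠ 0 := by
        rw [← hfval]; exact (f s).ne_zero
      have : PadicInt.toZMod (ζ ^ (s : ℕ)) * (PadicInt.toZMod (ζ ^ d) - 1) = 0 := by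
        rw [mul_sub, mul_one, sub_eq_zero]; exact hrs'
      rcases mul_eq_zero.mp this with h | h
      · exact absurd h hzs
      · rw [map_sub, map_one]; exact h
    rw [← norm_lt_one_iff_toZMod_eq_zero] at hcong
    exact absurd hnorm hcong.ne
  -- hence surjective (same finite cardinality)
  have hcard : Fintype.card (Fin (p - 1)) = Fintype.card (ZMod p)ˣ := by
    rw [Fintype.card_fin, ZMod.card_units]
  have hsurj : Function.Surjective f :=
    (Fintype.bijective_iff_injective_and_card f).mpr ⟨hinj, hcard⟩ |>.2
  -- the unit `α` reduces to some `f r`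
  have hαu : IsUnit (PadicInt.toZMod α) := (PadicInt.isUnit_iff.mpr hα).map _
  obtain ⟨r, hr⟩ := hsurj hαu.unit
  refine ⟨r, r.2, ?_⟩
  rw [norm_lt_one_iff_toZMod_eq_zero, map_sub, sub_eq_zero, ← hfval, hr]
  rfl

/-- The same in Yu's form: for a unit `α` there is `r' < p − 1` with `‖α ζ^{r'} − 1‖ < 1`
(`ord_p(α ζ^{r'} − 1) ≥ 1`). [cite: Yu1990, (2.19)–(2.24) (pp. 33–34)]
[cite: Serre1973, Ch. II §3.1 Prop. 7] -/
theorem padicInt_exists_norm_mul_pow_sub_one_lt {ζ : ℤ_[p]} (hζ : IsPrimitiveRoot ζ (p - 1))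
    {α : ℤ_[p]} (hα : ‖α‖ = 1) : ∃ r' : ℕ, r' < p - 1 ∧ ‖α * ζ ^ r' - 1‖ < 1 := by
  have hp : p.Prime := Fact.out
  obtain ⟨r, hr, hαr⟩ := padicInt_exists_norm_sub_pow_lt hζ hα
  rcases Nat.eq_zero_or_pos r with rfl | hr0
  · refine ⟨0, by have := hp.two_le; omega, ?_⟩
    simpa using hαr
  refine ⟨p - 1 - r, by omega, ?_⟩
  have hζn : ‖ζ ^ (p - 1 - r)‖ = 1 := by
    rw [norm_pow, PadicInt.isUnit_iff.mp (hζ.isUnit (by omega)), one_pow]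
  have hid : α * ζ ^ (p - 1 - r) - 1 = (α - ζ ^ r) * ζ ^ (p - 1 - r) := by
    have h1 : ζ ^ r * ζ ^ (p - 1 - r) = 1 := by
      rw [← pow_add, show r + (p - 1 - r) = p - 1 by omega, hζ.pow_eq_one]
    linear_combination h1
  rw [hid, norm_mul, hζn, mul_one]
  exact hαr

end Literature.NumberTheory.LocalFields

end
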